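import Summits.HodgeConjecture.CorCM.OcticCMFieldAutomorphismsFibres
import Literature.AlgebraicGeometry.Pohlmann1968.SimpleCMFourfoldNondegenerate
import Literature.AlgebraicGeometry.ComplexMultiplication.SimpleIffPrimitiveCMType
import HarnessLib

/-!
# Beyond Galois: a simple CM abelian fourfold whose CM field has an automorphism other than `1` and complex
# conjugation is nondegenerate — Dodson 1984 §3.3.2 (⟹) in automorphism form, classification-free

COR-CM (cell `pub-hodgecm2`), binder seat b04 (gen 13), count-neutral claim GALOIS-OCTIC, part IIIb; sequel of parts
I `CorCM/GaloisOcticStabiliserLemma`, II `CorCM/GaloisOcticSimpleCMFourfolds` (the Galois case), IIIa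
`CorCM/OcticCMFieldAutomorphismsFibres` (free action of `Aut(K)` on the embeddings, fibres, the stabiliser) and of
the tree's `Literature/AlgebraicGeometry/Pohlmann1968/SimpleCMFourfoldNondegenerate`
(`isNondegenerate_iff_forall_not_weilFibre`: a primitive octic CM type is degenerate iff it has multiplicities
`(2,2)` over a quadratic subfield with a complex place).  KERNEL ONLY: theorems, no definition, no named fact, no
`sorry`.  `HC_CM` is not used and not claimed: the Hodge conjecture below is for a NAMED SUB-CLASS of CM abelian
varieties.

## The print and what is new

[Dodson1984] §3.3.2 Theorem (p. 16; stated without proof in [Ribet1980], cf. Examples (3.7) there, "the tedious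
proof of this fact has been mislaid"): a simple CM abelian fourfold `A` of type `(K, Φ)` is degenerate iff
`Gal(K^c/ℚ) ∈ {ℤ₂ × A₄, ℤ₂ × S₄}` and `Φ` is the reflex of a sextic type.  Since a degenerate `K` contains an
imaginary quadratic field `k` acting with multiplicities `(2,2)` (Moonen–Zarhin; tree), `K = K⁺k`,
`Gal(K^c/ℚ) = ℤ₂ × Gal((K⁺)^c/ℚ)` and `Aut(K/ℚ) = Aut(K⁺/ℚ) × {1, c}`; so the forward direction of Dodson's
theorem says exactly: **the CM field of a degenerate simple CM fourfold has only the two automorphisms `1` and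
`c`** (`Aut(K⁺) = 1`, i.e. the closure of the totally real quartic `K⁺` is `A₄` or `S₄` — not `C₄`, `V₄`
(`K` Galois, part II) and not `D₄`).  This file proves that statement WITHOUT the classification of the `38`
`ρ`-structures for `n = 4` used in print, from the stabiliser of part IIIa:

* **`not_isPrimitive_of_fibres_balanced_of_ne_complexConj`** — given an automorphism `t ∉ {1, c}` of the octic CM
  field `K` and a CM type `Φ` balanced over an imaginary quadratic subfield `k`, some `a ≠ 1` (a power of an
  automorphism fixing `k`, possibly times `c`) has `Φ·a = Φ`, so two embeddings are not separated by the translates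
  of `Φ` (`isPrimitive_iff_forall_eq`): `Φ` is NOT primitive;
* **`isNondegenerate_of_isPrimitive_of_ne_complexConj`**, `isNondegenerate_of_isPrimitive_of_two_lt_card` — an octic
  CM field with an automorphism `t ∉ {1, c}` (equivalently `|Aut(K/ℚ)| > 2`) has all its primitive CM types
  nondegenerate;
* **`eq_one_or_eq_complexConj_of_not_isNondegenerate`**, **`card_algEquiv_eq_two_of_not_isNondegenerate`** — the CM
  field of a DEGENERATE simple CM fourfold has `Aut(K/ℚ) = {1, c}`;
* §5 realisations: `Bᵐ(Aⁿ) ⊗ ℂ = Dᵐ(Aⁿ) ⊗ ℂ` and **the Hodge conjecture for every power of every SIMPLE abelian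
  fourfold with complex multiplication by an octic CM field admitting an automorphism other than `1` and complex
  conjugation — UNCONDITIONALLY** (`hodgeConjectureFor_pow_of_isSimple_of_ne_complexConj`,
  `hodgeConjectureFor_pow_of_isSimple_of_two_lt_card`); an exceptional Hodge class on some power of a simple CM
  fourfold forces `|Aut(K/ℚ)| = 2` (`card_algEquiv_eq_two_of_isSimple_of_exceptional`).  This class contains part
  II's (Galois `K`, `|Aut| = 8`) and the fields `K = K⁺k` with `K⁺` a totally real quartic of dihedral type
  (`|Aut(K/ℚ)| = 4`: `K⁺` non-normal with a quadratic subfield).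

NOT here: the converse (degenerate simple CM fourfolds with `Aut(K) = {1, c}` exist — Mumford's example, tree
`Pohlmann1968/MumfordSimpleFourfold*`) and Dodson's refinement "`Φ` is the reflex of a sextic type".
-/

noncomputable section

open CategoryTheory CategoryTheory.Limits NumberField

namespace Summit.HodgeConjecture.CorCM.GaloisOctic

open Literature.NumberTheory.ComplexMultiplication
open Literature.AlgebraicGeometry.Motives (AbelianVariety CMType)
open Literature.AlgebraicGeometry.Pohlmann1968
open Literature.AlgebraicGeometry.HodgeTheory
open Literature.AlgebraicGeometry.ComplexMultiplication (IsCMTypeRealisation isSimple_iff_isPrimitive)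
open Literature.AlgebraicGeometry.VanGeemen1994 (hodgeClassSpan)
open Literature.Barriers.HodgeConjecture (divisorClassesSpan)

open scoped Classical

/-! ## §4 The theorems: an automorphism other than `1, c` forces nondegeneracy -/

section Main

variable {K : Type} [Field K] [NumberField K] [IsCMField K] {Φ : CMType K}

/-- **A CM type of an octic CM field with multiplicities `(2,2)` over a quadratic subfield with a complex place is
NOT primitive as soon as the field has an automorphism `t ∉ {1, c}`** — the free-action form of the stabiliser
lemma: some `a ≠ 1` (a power of an automorphism fixing `k`, possibly times `c`) satisfies `Φ·a = Φ`, so the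
translates of `Φ` under `Aut(ℂ)` do not separate `φ₀` from `φ₀ ∘ a⁻¹` (`isPrimitive_iff_forall_eq`).  The print
proves the corresponding statement by the classification of the Galois closures. [cite: Dodson1984, §3.3.2 Theorem (p. 16)] -/
theorem not_isPrimitive_of_fibres_balanced_of_ne_complexConj (hK : Module.finrank ℚ K = 8) (φ₀ : K →+* ℂ)
    (k : IntermediateField ℚ K) (hk2 : Module.finrank ℚ k = 2) (τ₀ : k →+* ℂ)
    (hτ₀ : ComplexEmbedding.conjugate τ₀ ≠ τ₀)
    (hbal : ∀ τ : k →+* ℂ, {φ : K →+* ℂ | φ.comp (algebraMap k K) = τ ∧ φ ∈ Φ.1}.ncard =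
      {φ : K →+* ℂ | φ.comp (algebraMap k K) = τ ∧ φ ∉ Φ.1}.ncard)
    (t : K ≃ₐ[ℚ] K) (ht1 : t ≠ 1) (htc : t ≠ (IsCMField.complexConj K).restrictScalars ℚ) :
    ¬ IsPrimitive (ℂ ≃+* ℂ) Φ.1 φ₀ := by
  haveI := isPretransitive_ringEquiv_complex (K := K)
  set c : K ≃ₐ[ℚ] K := (IsCMField.complexConj K).restrictScalars ℚ with hc_def
  -- a non-trivial automorphism fixing `k`
  obtain ⟨t', ht'H, ht'1⟩ := exists_mem_fixingSubgroup_ne_one k hk2 τ₀ hτ₀ t ht1 htc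
  -- the fibre over `τ := φ₀|_k`: `S = {p, q}`, `|S′| = 2`
  set τ : k →+* ℂ := φ₀.comp (algebraMap k K) with hτ_def
  have hτ : ComplexEmbedding.conjugate τ ≠ τ := conjugate_ne_of_finrank_eq_two k hk2 τ₀ hτ₀ φ₀
  obtain ⟨hS2, hS'2⟩ := ncard_fibre_eq_two hK Φ k hk2 τ hτ (hbal τ)
  obtain ⟨p, q, hpq, hSpq⟩ := Set.ncard_eq_two.1 hS2
  have hp : p.comp (algebraMap k K) = τ ∧ p ∈ Φ.1 := by
    have : p ∈ ({p, q} : Set (K →+* ℂ)) := Set.mem_insert p {q}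
    rw [← hSpq] at this; exact this
  have hq : q.comp (algebraMap k K) = τ ∧ q ∈ Φ.1 := by
    have : q ∈ ({p, q} : Set (K →+* ℂ)) := Set.mem_insert_of_mem p rfl
    rw [← hSpq] at this; exact this
  have hS : ∀ ψ : K →+* ℂ, ψ.comp (algebraMap k K) = τ → ψ ∈ Φ.1 → ψ = p ∨ ψ = q := by
    intro ψ h1 h2
    have : ψ ∈ ({p, q} : Set (K →+* ℂ)) := by rw [← hSpq]; exact ⟨h1, h2⟩
    simpa only [Set.mem_insert_iff, Set.mem_singleton_iff] using this
  have hfib : ∀ (ψ : K →+* ℂ) (b : K ≃ₐ[ℚ] K), b ∈ k.fixingSubgroup → ψ.comp (algebraMap k K) = τ →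
      (embOf ψ b).comp (algebraMap k K) = τ := fun ψ b hb hψ => (comp_algebraMap_embOf_of_mem hb ψ).trans hψ
  have hcH : c ∉ k.fixingSubgroup := complexConj_not_mem_fixingSubgroup' k τ₀ hτ₀
  -- it suffices to find `a ≠ 1` with `Φ·a = Φ`
  suffices key : ∃ a : K ≃ₐ[ℚ] K, a ≠ 1 ∧ ∀ ψ : K →+* ℂ, ψ ∈ Φ.1 ↔ embOf ψ a ∈ Φ.1 by
    obtain ⟨a, ha1, ha⟩ := key
    rw [isPrimitive_iff_forall_eq]
    intro hsep
    have hne : φ₀ ≠ embOf φ₀ a := fun h => ha1 ((embOf_eq_self_iff φ₀ a).1 h.symm)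
    exact hne (hsep _ _ fun γ => by rw [smul_embOf]; exact ha (γ • φ₀))
  -- from `S·a ⊆ S` resp. `S·a ⊆ S′` to `Φ·a = Φ` resp. `Φ·(ca) = Φ`
  have finishA : ∀ a : K ≃ₐ[ℚ] K, a ∈ k.fixingSubgroup → a ≠ 1 →
      (∀ ψ : K →+* ℂ, ψ.comp (algebraMap k K) = τ → ψ ∈ Φ.1 → embOf ψ a ∈ Φ.1) →
      ∃ a' : K ≃ₐ[ℚ] K, a' ≠ 1 ∧ ∀ ψ : K →+* ℂ, ψ ∈ Φ.1 ↔ embOf ψ a' ∈ Φ.1 :=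
    fun a ha ha1 hA => ⟨a, ha1, forall_mem_iff_embOf_mem_of_mapsTo hk2 hτ ha hA⟩
  have finishB : ∀ a : K ≃ₐ[ℚ] K, a ∈ k.fixingSubgroup →
      (∀ ψ : K →+* ℂ, ψ.comp (algebraMap k K) = τ → ψ ∈ Φ.1 → embOf ψ a ∉ Φ.1) →
      ∃ a' : K ≃ₐ[ℚ] K, a' ≠ 1 ∧ ∀ ψ : K →+* ℂ, ψ ∈ Φ.1 ↔ embOf ψ a' ∈ Φ.1 := by
    intro a ha hB
    refine ⟨c * a, fun h => hcH ?_, forall_mem_iff_embOf_not_mem_of_mapsTo hk2 hτ ha (hS2.trans hS'2.symm) hB⟩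
    rw [eq_inv_of_mul_eq_one_left h]
    exact inv_mem ha
  -- casework: where do `p·t′`, `q·t′` go?
  by_cases hpt : embOf p t' ∈ Φ.1 <;> by_cases hqt : embOf q t' ∈ Φ.1
  · exact finishA t' ht'H ht'1 fun ψ h1 h2 => by
      rcases hS ψ h1 h2 with rfl | rfl <;> assumption
  · have hpt' : embOf p t' = q := by
      rcases hS _ (hfib p t' ht'H hp.1) hpt with e | e
      · exact absurd ((embOf_eq_self_iff p t').1 e) ht'1
      · exact e
    obtain ⟨-, hp2, hq2⟩ := sq_mapsTo_compl_of_asym hp.1 hp.2 hq.2 hS hS'2 ht'H hpt' hqt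
    exact finishB (t' * t') (mul_mem ht'H ht'H) fun ψ h1 h2 => by
      rcases hS ψ h1 h2 with rfl | rfl <;> assumption
  · have hqt' : embOf q t' = p := by
      rcases hS _ (hfib q t' ht'H hq.1) hqt with e | e
      · exact e
      · exact absurd ((embOf_eq_self_iff q t').1 e) ht'1
    have hS' : ∀ ψ : K →+* ℂ, ψ.comp (algebraMap k K) = τ → ψ ∈ Φ.1 → ψ = q ∨ ψ = p :=
      fun ψ h1 h2 => (hS ψ h1 h2).symm
    obtain ⟨-, hq2, hp2⟩ := sq_mapsTo_compl_of_asym hq.1 hq.2 hp.2 hS' hS'2 ht'H hqt' hpt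
    exact finishB (t' * t') (mul_mem ht'H ht'H) fun ψ h1 h2 => by
      rcases hS ψ h1 h2 with rfl | rfl <;> assumption
  · exact finishB t' ht'H fun ψ h1 h2 => by
      rcases hS ψ h1 h2 with rfl | rfl <;> assumption

/-- **Every PRIMITIVE CM type of an octic CM field with an automorphism other than `1` and complex conjugation is
NONDEGENERATE** (rank `5`; Gordon 5.13 case (i)) — by `isNondegenerate_iff_forall_not_weilFibre` and
`not_isPrimitive_of_fibres_balanced_of_ne_complexConj`.  Contains the Galois case (part II) and the octic CM fields
`K⁺k` with `K⁺` of dihedral type; the print's form: degenerate forces the closure `ℤ₂ × A₄` or `ℤ₂ × S₄`.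
[cite: Dodson1984, §3.3.2 Theorem (p. 16)] [cite: Ribet1980, Examples (3.7) (pp. 87–88)] -/
theorem isNondegenerate_of_isPrimitive_of_ne_complexConj (hK : Module.finrank ℚ K = 8) (φ₀ : K →+* ℂ)
    (hprim : IsPrimitive (ℂ ≃+* ℂ) Φ.1 φ₀) (t : K ≃ₐ[ℚ] K) (ht1 : t ≠ 1)
    (htc : t ≠ (IsCMField.complexConj K).restrictScalars ℚ) : IsNondegenerate Φ := by
  rw [isNondegenerate_iff_forall_not_weilFibre hK φ₀ hprim]
  intro k hk2 τ₀ hτ₀ hbal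
  exact not_isPrimitive_of_fibres_balanced_of_ne_complexConj hK φ₀ k hk2 τ₀ hτ₀ hbal t ht1 htc hprim

/-- Complex conjugation of a CM field is not the identity (in `Gal(K/ℚ)`). [folklore] -/
theorem complexConj_restrictScalars_ne_one : (IsCMField.complexConj K).restrictScalars ℚ ≠ (1 : K ≃ₐ[ℚ] K) := by
  intro h
  apply IsCMField.complexConj_ne_one K
  refine AlgEquiv.ext fun x => ?_
  have := AlgEquiv.congr_fun h x
  rwa [AlgEquiv.restrictScalars_apply] at this

/-- **Dodson 1984 §3.3.2 (⟹), automorphism form: the CM field of a DEGENERATE simple CM abelian fourfold has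
no automorphism besides `1` and complex conjugation** (equivalently `Aut(K⁺/ℚ) = 1` for `K = K⁺k`: the Galois
closure of the totally real quartic `K⁺` has group `A₄` or `S₄`).  Classification-free proof.
[cite: Dodson1984, §3.3.2 Theorem (p. 16)] -/
theorem eq_one_or_eq_complexConj_of_not_isNondegenerate (hK : Module.finrank ℚ K = 8) (φ₀ : K →+* ℂ)
    (hprim : IsPrimitive (ℂ ≃+* ℂ) Φ.1 φ₀) (hdeg : ¬ IsNondegenerate Φ) (a : K ≃ₐ[ℚ] K) :
    a = 1 ∨ a = (IsCMField.complexConj K).restrictScalars ℚ := by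
  by_contra h
  push Not at h
  exact hdeg (isNondegenerate_of_isPrimitive_of_ne_complexConj hK φ₀ hprim a h.1 h.2)

/-- **`|Aut(K/ℚ)| = 2` for the CM field of a degenerate simple CM abelian fourfold.** [cite: Dodson1984, §3.3.2 Theorem (p. 16)] -/
theorem card_algEquiv_eq_two_of_not_isNondegenerate (hK : Module.finrank ℚ K = 8) (φ₀ : K →+* ℂ)
    (hprim : IsPrimitive (ℂ ≃+* ℂ) Φ.1 φ₀) (hdeg : ¬ IsNondegenerate Φ) : Nat.card (K ≃ₐ[ℚ] K) = 2 := by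
  rw [Nat.card_eq_two_iff' (1 : K ≃ₐ[ℚ] K)]
  refine ⟨(IsCMField.complexConj K).restrictScalars ℚ, complexConj_restrictScalars_ne_one, fun a ha => ?_⟩
  exact (eq_one_or_eq_complexConj_of_not_isNondegenerate hK φ₀ hprim hdeg a).resolve_left ha

/-- **More than two automorphisms force nondegeneracy**: if `2 < |Aut(K/ℚ)|` (e.g. `K` Galois: `8`; `K = K⁺k`
with `K⁺` a `D₄`-quartic: `4`), every primitive CM type of the octic CM field `K` is nondegenerate.
[cite: Dodson1984, §3.3.2 Theorem (p. 16)] -/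
theorem isNondegenerate_of_isPrimitive_of_two_lt_card (hK : Module.finrank ℚ K = 8) (φ₀ : K →+* ℂ)
    (hprim : IsPrimitive (ℂ ≃+* ℂ) Φ.1 φ₀) (hA : 2 < Nat.card (K ≃ₐ[ℚ] K)) : IsNondegenerate Φ := by
  by_contra hdeg
  rw [card_algEquiv_eq_two_of_not_isNondegenerate hK φ₀ hprim hdeg] at hA
  exact lt_irrefl 2 hA

end Main

/-! ## §5 Realisations: the Hodge conjecture for all powers of such simple CM fourfolds -/

section Geometry

variable {K : Type} [Field K] [NumberField K] [IsCMField K] {Φ : CMType K}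
variable {A : AbelianVariety ℂ} {ι : 𝓞 K →+* End A} {θ : K →+* Module.End ℂ (complexBetti A.X 1)}

/-- **A simple abelian fourfold with CM by an octic CM field having an automorphism `t ∉ {1, c}` realises a
nondegenerate type** (`A` simple ⟺ `Φ` primitive, tree `isSimple_iff_isPrimitive`). [cite: Dodson1984, §3.3.2 Theorem (p. 16)]
[cite: Shimura1998, §8.2 Prop. 26] -/
theorem isNondegenerate_of_isSimple_of_ne_complexConj (hK : Module.finrank ℚ K = 8)
    (hA : IsCMTypeRealisation Φ A ι θ) (hs : A.IsSimple) (t : K ≃ₐ[ℚ] K) (ht1 : t ≠ 1)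
    (htc : t ≠ (IsCMField.complexConj K).restrictScalars ℚ) : IsNondegenerate Φ := by
  obtain ⟨φ₀⟩ := (inferInstance : Nonempty (K →+* ℂ))
  exact isNondegenerate_of_isPrimitive_of_ne_complexConj hK φ₀ ((isSimple_iff_isPrimitive hA φ₀).1 hs) t ht1 htc

/-- **`Bᵐ(Aⁿ) ⊗ ℂ = Dᵐ(Aⁿ) ⊗ ℂ` on every power** of such a simple CM fourfold. [cite: Gordon1999HodgeAVSurvey, 5.13 (i) and Thm. 6.4] -/
theorem hodgeClassSpan_pow_eq_divisorClassesSpan_of_isSimple_of_ne_complexConj (hK : Module.finrank ℚ K = 8)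
    (hA : IsCMTypeRealisation Φ A ι θ) (hs : A.IsSimple) (t : K ≃ₐ[ℚ] K) (ht1 : t ≠ 1)
    (htc : t ≠ (IsCMField.complexConj K).restrictScalars ℚ) (n m : ℕ) :
    hodgeClassSpan (⨁ fun _ : Fin n => A).dim (⨁ fun _ : Fin n => A).X m =
      divisorClassesSpan (⨁ fun _ : Fin n => A).X (⨁ fun _ : Fin n => A).dim m :=
  (isNondegenerate_of_isSimple_of_ne_complexConj hK hA hs t ht1 htc).hodgeClassSpan_pow_eq_divisorClassesSpan hA n m

/-- **THE HODGE CONJECTURE FOR EVERY POWER `Aⁿ` OF EVERY SIMPLE ABELIAN FOURFOLD WITH COMPLEX MULTIPLICATION BY AN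
OCTIC CM FIELD ADMITTING AN AUTOMORPHISM OTHER THAN `1` AND COMPLEX CONJUGATION — UNCONDITIONALLY** (no named fact).
[cite: Dodson1984, §3.3.2 Theorem (p. 16)] [cite: Gordon1999HodgeAVSurvey, 5.13 (i) and Thm. 6.4] -/
theorem hodgeConjectureFor_pow_of_isSimple_of_ne_complexConj (hK : Module.finrank ℚ K = 8)
    (hA : IsCMTypeRealisation Φ A ι θ) (hs : A.IsSimple) (t : K ≃ₐ[ℚ] K) (ht1 : t ≠ 1)
    (htc : t ≠ (IsCMField.complexConj K).restrictScalars ℚ) (n : ℕ) :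
    HodgeConjectureFor (⨁ fun _ : Fin n => A).dim (⨁ fun _ : Fin n => A).X :=
  (isNondegenerate_of_isSimple_of_ne_complexConj hK hA hs t ht1 htc).hodgeConjectureFor_pow hA n

/-- The same for the variety itself. [cite: Dodson1984, §3.3.2 Theorem (p. 16)] [cite: Gordon1999HodgeAVSurvey, 5.13 (i)] -/
theorem hodgeConjectureFor_of_isSimple_of_ne_complexConj (hK : Module.finrank ℚ K = 8)
    (hA : IsCMTypeRealisation Φ A ι θ) (hs : A.IsSimple) (t : K ≃ₐ[ℚ] K) (ht1 : t ≠ 1)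
    (htc : t ≠ (IsCMField.complexConj K).restrictScalars ℚ) : HodgeConjectureFor A.dim A.X :=
  (isNondegenerate_of_isSimple_of_ne_complexConj hK hA hs t ht1 htc).hodgeConjectureFor hA

/-- **The Hodge conjecture for all powers of every simple CM abelian fourfold whose CM field has more than two
automorphisms** — UNCONDITIONALLY. [cite: Dodson1984, §3.3.2 Theorem (p. 16)] [cite: Gordon1999HodgeAVSurvey, Thm. 6.4] -/
theorem hodgeConjectureFor_pow_of_isSimple_of_two_lt_card (hK : Module.finrank ℚ K = 8)
    (hA : IsCMTypeRealisation Φ A ι θ) (hs : A.IsSimple) (hcard : 2 < Nat.card (K ≃ₐ[ℚ] K)) (n : ℕ) :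
    HodgeConjectureFor (⨁ fun _ : Fin n => A).dim (⨁ fun _ : Fin n => A).X := by
  obtain ⟨φ₀⟩ := (inferInstance : Nonempty (K →+* ℂ))
  exact (isNondegenerate_of_isPrimitive_of_two_lt_card hK φ₀ ((isSimple_iff_isPrimitive hA φ₀).1 hs)
    hcard).hodgeConjectureFor_pow hA n

/-- **An exceptional Hodge class on some power of a simple CM abelian fourfold pins down the automorphism group
of its CM field: `Aut(K/ℚ) = {1, c}`** (a rational `(m,m)`-class outside `Dᵐ(Aⁿ) ⊗ ℂ` makes the type degenerate).
[cite: Dodson1984, §3.3.2 Theorem (p. 16)] [cite: MoonenZarhin1995Duke, Thm. 2.4] -/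
theorem card_algEquiv_eq_two_of_isSimple_of_exceptional (hK : Module.finrank ℚ K = 8)
    (hA : IsCMTypeRealisation Φ A ι θ) (hs : A.IsSimple) {n m : ℕ}
    {x : complexBetti (⨁ fun _ : Fin n => A).X (2 * m)} (hxQ : IsRationalClass x)
    (hxH : IsOfHodgeType (⨁ fun _ : Fin n => A).dim (⨁ fun _ : Fin n => A).X (2 * m) m m x)
    (hx : x ∉ divisorClassesSpan (⨁ fun _ : Fin n => A).X (⨁ fun _ : Fin n => A).dim m) :
    Nat.card (K ≃ₐ[ℚ] K) = 2 := by
  obtain ⟨φ₀⟩ := (inferInstance : Nonempty (K →+* ℂ))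
  refine card_algEquiv_eq_two_of_not_isNondegenerate hK φ₀ ((isSimple_iff_isPrimitive hA φ₀).1 hs) fun hΦ => ?_
  exact hx (hΦ.mem_divisorClassesSpan_pow hA n m hxQ hxH)

end Geometry

end Summit.HodgeConjecture.CorCM.GaloisOctic

end
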